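import Summits.ValiantsHypothesis.ValiantsHypothesis.Theorems.LacunarySymmetroidMatrixDescartesCensusPivotNormalForm
import Summits.ValiantsHypothesis.ValiantsHypothesis.Theorems.SymmetroidDescartesDerivedPencilRolleRefutation
import Literature.LinearAlgebra.MatrixPolynomials.CameronPsarrakos2019.Witness

/-!
# `MatrixDescartes` census — pivot column: the shape «polynomial in `(m, K, q)`» is DEAD (`¬ IndexPolyLaw`)

HONEST FRAMING.  Object-search cell `pub-symmetroid`, pivot column of the crux `Theses.LacunarySymmetroid.MatrixDescartes`
(stmt-ValiantsHypothesis-18050, OPEN).  conjb-1 g4's ROUND-4 memo (`HOME/pub-symmetroid-conjb-1/g4/ROUND4-MEMO.md` §3, sketch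
`ConjB1SketchR5.lean`) types the law shape «`Z₊ ≤ (m(K+1))^c (q+1)^c` for all pivot pencils» as `IndexPolyLaw` and records it as
DEAD by the lifted staircase (FACT A, conjb-1 g0 §5: «index is not a polynomial resource»); the kernel refutation was owed
(memo O4-1, desk R1467).  This file types the `Prop` VERBATIM over the tree's vocabulary (`Pivot.PivotRootLawAt`) and proves
`Pivot.not_indexPolyLaw : ¬ IndexPolyLaw`.  Ingredients, all tree theorems:

* the STAIRCASE family of the `DerivedPencilRolle` refutation (`SymmetroidDescartes.DPR.stub_stair`,
  `DPR.exists_symm_pencil_alternating`, `DPR.stub_arith`): symmetric pencils with `6a+3` letters of size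
  `m₀ = 4((g.length+1)·|V|)³+7` whose determinant alternates `n^{6a+1} − 1` times along positive points;
* IVT: alternations ⇒ distinct positive roots (`Literature…CameronPsarrakos2019.le_card_posRoots_of_alternating`);
* the OneIndefinite LIFT of line `Lift` (`stub_liftDet`, `stub_psdBlocks`, `stub_psdDominate`, `…LiftNormalForm`): an arbitrary
  symmetric `K`-letter pencil of size `m` has the positive roots of a pivot pencil of size `mK + m` with `2K` PSD letters and
  pivot `J = [[0, Wᵀ], [W, 0]]`, whose index is witnessed by `W′ = (Wᵀ ; −1)`: `J + W′W′ᵀ = diag(WᵀW, 1) ⪰ 0`, `q = m`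
  (`card_posRoots_le_of_pivotRootLawAt_lift`, via the tree's `card_posRoots_le_of_pivotLaw_index`);
* arithmetic: `((mK+m)(2K+1))^c (m+1)^c ≤ K (2^c)^K (m+K)^{4c}`, which `DPR.stub_arith (2^c) (4c)` beats by `n^{24c+1} − 1`.

Also `pivotIndexLawPoly_of_indexPolyLaw` (conjb-1 g4, verbatim): the dead shape sits below the OPEN `PivotIndexLawPoly`
(`(q+1)^{C⌊log₂(m+1)⌋}`), which is NOT refuted here.  Nothing in this file bears on `PivotIndexLaw` / `PivotIndexLawK` /
`PivotIndexLawPoly`, on `MatrixDescartes`, or on `VP ≠ VNP`.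

[folklore] Assembly of tree theorems; elementary.
-/

-- `Summit.ValiantsHypothesis.ValiantsHypothesis.…` repeats a component by the D-0017 layout
-- (single-conjunct summit), which the `dupNamespace` linter flags; the name is mandated.
set_option linter.dupNamespace false

namespace Summit.ValiantsHypothesis.ValiantsHypothesis.Theorems.LacunarySymmetroidMatrixDescartes.Pivot

open Polynomial Matrix Finset
open scoped BigOperators

/-- **`IndexPolyLaw`** (conjb-1 g4, `ConjB1SketchR5.lean`, verbatim): SOME bound polynomial in the size `m`, the number of PSD
letters `K` and the pivot index `q` — `Z₊ ≤ (m(K+1))^c (q+1)^c` — holds for every pivot pencil.  REFUTED below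
(`not_indexPolyLaw`); typed only so that the refutation has a name.  Compare the OPEN `PivotIndexLawPoly`
(`(q+1)^{C⌊log₂(m+1)⌋}` in place of `(q+1)^c`). [definition of the cell (conjb-1 g4); no citation exists] -/
def IndexPolyLaw : Prop := ∃ c : ℕ, ∀ m K q : ℕ, PivotRootLawAt m K q ((m * (K + 1)) ^ c * (q + 1) ^ c)

/-- The dead shape dominates the live one: `IndexPolyLaw → PivotIndexLawPoly` (for `m ≥ 1`, `(q+1)^c ≤ (q+1)^{c ⌊log₂(m+1)⌋}`;
`m = 0` has no roots).  (conjb-1 g4, `ConjB1SketchR5.lean`, verbatim.) [folklore] -/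
theorem pivotIndexLawPoly_of_indexPolyLaw (h : IndexPolyLaw) : PivotIndexLawPoly := by
  obtain ⟨c, hc⟩ := h
  refine ⟨c, fun m K q => ?_⟩
  rcases Nat.eq_zero_or_pos m with rfl | hm
  · -- size 0: the `0 × 0` determinant is the constant `1`, no roots at all
    intro e d J P hJ hP hW
    unfold pivotPosRoots
    have hdet : Matrix.det (((X : ℝ[X]) ^ e) • J.map Polynomial.C + ∑ k, ((X : ℝ[X]) ^ d k) • (P k).map Polynomial.C) = 1 :=
      Matrix.det_isEmpty
    rw [hdet, Polynomial.roots_one]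
    simp
  · refine pivotRootLawAt_mono (hc m K q) (Nat.mul_le_mul_left _ ?_)
    refine Nat.pow_le_pow_right (Nat.succ_pos q) ?_
    have h1 : 1 ≤ Nat.log 2 (m + 1) := Nat.le_log_of_pow_le (by norm_num) (by omega)
    calc c = c * 1 := (Nat.mul_one c).symm
      _ ≤ c * Nat.log 2 (m + 1) := Nat.mul_le_mul_left c h1

/-- **The OneIndefinite lift bounds an arbitrary symmetric pencil by a pivot row with an explicit index witness.**  If the
pivot row at format `(mK + m, 2K)`, index `m`, budget `B` holds, then EVERY real symmetric `K`-letter pencil of size `m`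
has at most `B` distinct positive determinant roots: lift it (line `Lift`: rows `(Fin m × Fin K) ⊕ Fin m`, letters
`Fin K ⊕ Fin K`, pivot `J = [[0, Wᵀ], [W, 0]]`, PSD letters `diag(γ⁻¹ on colour l) ⊕ 0` and `0 ⊕ (γ•1 − S l)`, `det` of the lift
`= C a · X^M · det` of the pencil by `stub_liftDet`) and witness the index by `W′ = (Wᵀ ; −1)`, `J + W′W′ᵀ = diag(WᵀW, 1) ⪰ 0`. [folklore] -/
theorem card_posRoots_le_of_pivotRootLawAt_lift {K m B : ℕ} (h : PivotRootLawAt (m * K + m) (K + K) m B)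
    (d : Fin K → ℕ) (S : Fin K → Matrix (Fin m) (Fin m) ℝ) (hS : ∀ l, (S l).IsSymm) :
    ((Matrix.det (∑ l, ((X : ℝ[X]) ^ d l) • (S l).map Polynomial.C)).roots.toFinset.filter (fun t => 0 < t)).card
      ≤ B := by
  classical
  let ι : Type := (Fin m × Fin K) ⊕ Fin m
  let κ : Type := Fin K ⊕ Fin K
  have hcardκ : Fintype.card κ = K + K := by
    simp [κ, Fintype.card_sum, Fintype.card_fin]
  have hcardι : Fintype.card ι = m * K + m := by
    simp [ι, Fintype.card_sum, Fintype.card_prod, Fintype.card_fin]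
  set e : ℕ := ∑ l, d l with hedef
  have he : ∀ l, d l ≤ e := fun l =>
    Finset.single_le_sum (f := d) (fun i _ => Nat.zero_le _) (Finset.mem_univ l)
  let W : Matrix (Fin m) (Fin m × Fin K) ℝ :=
    Matrix.of fun (i : Fin m) (jl : Fin m × Fin K) => if i = jl.1 then (1 : ℝ) else 0
  let J : Matrix ι ι ℝ :=
    Matrix.fromBlocks (0 : Matrix (Fin m × Fin K) (Fin m × Fin K) ℝ) Wᵀ W (0 : Matrix (Fin m) (Fin m) ℝ)
  have hJ : J.IsSymm := by
    show (Matrix.fromBlocks 0 Wᵀ W 0)ᵀ = Matrix.fromBlocks 0 Wᵀ W 0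
    rw [Matrix.fromBlocks_transpose, Matrix.transpose_zero, Matrix.transpose_zero,
      Matrix.transpose_transpose]
  let d' : κ → ℕ := Sum.elim (fun l => e - d l) (fun l => e + d l)
  set γ : Fin K → ℝ := fun l => 1 + ∑ i, ∑ j, S l i j ^ 2 with hγdef
  have hγpos : ∀ l, 0 < γ l := fun l => by
    simp only [hγdef]
    positivity
  have hγ : ∀ l, γ l ≠ 0 := fun l => ne_of_gt (hγpos l)
  let P : κ → Matrix ι ι ℝ := Sum.elim
    (fun l => Matrix.fromBlocks
      (Matrix.diagonal fun jl : Fin m × Fin K => if jl.2 = l then (γ l)⁻¹ else 0)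
      0 0 (0 : Matrix (Fin m) (Fin m) ℝ))
    (fun l => Matrix.fromBlocks (0 : Matrix (Fin m × Fin K) (Fin m × Fin K) ℝ) 0 0
      (γ l • (1 : Matrix (Fin m) (Fin m) ℝ) - S l))
  have hP : ∀ k, (P k).PosSemidef := by
    obtain ⟨h1, h2⟩ := stub_psdBlocks K m
    intro k
    cases k with
    | inl l =>
        simp only [P, Sum.elim_inl]
        exact h1 l _ (le_of_lt (inv_pos.mpr (hγpos l)))
    | inr l =>
        simp only [P, Sum.elim_inr]
        exact h2 _ (by simpa [hγdef] using stub_psdDominate m (S l) (hS l))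
  -- the index witness `W′ = (Wᵀ ; −1)`
  let W' : Matrix ι (Fin m) ℝ := Matrix.fromRows Wᵀ (-1 : Matrix (Fin m) (Fin m) ℝ)
  have hW' : (J + W' * W'ᵀ).PosSemidef := by
    have hprod : W' * W'ᵀ = Matrix.fromBlocks (Wᵀ * W) (-Wᵀ) (-W) 1 := by
      show Matrix.fromRows Wᵀ (-1 : Matrix (Fin m) (Fin m) ℝ) * (Matrix.fromRows Wᵀ (-1 : Matrix (Fin m) (Fin m) ℝ))ᵀ = _
      rw [Matrix.transpose_fromRows, Matrix.fromRows_mul_fromCols, Matrix.transpose_transpose, Matrix.transpose_neg,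
        Matrix.transpose_one, Matrix.mul_neg, Matrix.mul_one, Matrix.neg_mul, Matrix.neg_mul, Matrix.one_mul,
        Matrix.one_mul, neg_neg]
    have hsum : J + W' * W'ᵀ = Matrix.fromBlocks (Wᵀ * W) 0 0 1 := by
      rw [hprod]
      show Matrix.fromBlocks 0 Wᵀ W 0 + _ = _
      simp only [Matrix.fromBlocks_add, zero_add, add_neg_cancel]
    rw [hsum]
    refine posSemidef_fromBlocks_zero ?_ Matrix.PosSemidef.one
    have hWW := Matrix.posSemidef_conjTranspose_mul_self W
    rwa [Matrix.conjTranspose_eq_transpose_of_trivial] at hWW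
  have h' : PivotRootLawAt (Fintype.card ι) (Fintype.card κ) m B := by
    rw [hcardι, hcardκ]
    exact h
  have hC := card_posRoots_le_of_pivotLaw_index h' e d' J P hJ hP W' hW'
  have hsum : ∑ k, ((Polynomial.X : Polynomial ℝ) ^ d' k) • (P k).map Polynomial.C
      = ∑ l : Fin K, ((Polynomial.X : Polynomial ℝ) ^ (e - d l)) •
            (Matrix.fromBlocks
              (Matrix.diagonal fun jl : Fin m × Fin K => if jl.2 = l then (γ l)⁻¹ else 0)
              0 0 (0 : Matrix (Fin m) (Fin m) ℝ)).map Polynomial.C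
        + ∑ l : Fin K, ((Polynomial.X : Polynomial ℝ) ^ (e + d l)) •
            (Matrix.fromBlocks (0 : Matrix (Fin m × Fin K) (Fin m × Fin K) ℝ) 0 0
              (γ l • (1 : Matrix (Fin m) (Fin m) ℝ) - S l)).map Polynomial.C := by
    simp only [κ, Fintype.sum_sum_type, d', P, Sum.elim_inl, Sum.elim_inr]
  rw [hsum, ← add_assoc] at hC
  obtain ⟨a, M, ha, hdet⟩ := stub_liftDet K m γ hγ d e he S
  rwa [LiftNormalForm.posRoots_eq_of_eq_C_mul_X_pow_mul _ _ a M ha hdet] at hC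

/-- Arithmetic: the polynomial budget of `IndexPolyLaw` at the lift's format is below the `DerivedPencilRolle` bound shape
`K · C^K · (m + K)^a` with `C = 2^c`, `a = 4c` (for `K, m ≥ 1`). [folklore] -/
theorem indexPolyLaw_budget_le (c K m : ℕ) (hK : 1 ≤ K) (hm : 1 ≤ m) :
    ((m * K + m) * (K + K + 1)) ^ c * (m + 1) ^ c ≤ K * (2 ^ c) ^ K * (m + K) ^ (4 * c) := by
  have h1 : (m * K + m) * (K + K + 1) ≤ 2 * (m + K) ^ 3 := by
    have e1 : (m * K + m) * (K + K + 1) = m * ((K + 1) * (K + K + 1)) := by ring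
    have e2 : 2 * (m + K) ^ 3 = (m + K) * ((m + K) * (2 * (m + K))) := by ring
    rw [e1, e2]
    exact Nat.mul_le_mul (by omega) (Nat.mul_le_mul (by omega) (by omega))
  have h2 : ((m * K + m) * (K + K + 1)) ^ c * (m + 1) ^ c ≤ (2 * (m + K) ^ 3) ^ c * (m + K) ^ c :=
    Nat.mul_le_mul (Nat.pow_le_pow_left h1 c) (Nat.pow_le_pow_left (by omega) c)
  have h3 : (2 * (m + K) ^ 3) ^ c * (m + K) ^ c = 2 ^ c * (m + K) ^ (4 * c) := by
    rw [mul_pow, ← pow_mul, mul_assoc, ← pow_add, show 3 * c + c = 4 * c by ring]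
  have h4 : 2 ^ c ≤ (2 ^ c) ^ K := Nat.le_self_pow (by omega) _
  have h5 : 2 ^ c * (m + K) ^ (4 * c) ≤ K * (2 ^ c) ^ K * (m + K) ^ (4 * c) :=
    calc 2 ^ c * (m + K) ^ (4 * c) ≤ (2 ^ c) ^ K * (m + K) ^ (4 * c) := Nat.mul_le_mul_right _ h4
      _ = 1 * ((2 ^ c) ^ K * (m + K) ^ (4 * c)) := by ring
      _ ≤ K * ((2 ^ c) ^ K * (m + K) ^ (4 * c)) := Nat.mul_le_mul_right _ hK
      _ = K * (2 ^ c) ^ K * (m + K) ^ (4 * c) := by ring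
  calc ((m * K + m) * (K + K + 1)) ^ c * (m + 1) ^ c ≤ (2 * (m + K) ^ 3) ^ c * (m + K) ^ c := h2
    _ = 2 ^ c * (m + K) ^ (4 * c) := h3
    _ ≤ K * (2 ^ c) ^ K * (m + K) ^ (4 * c) := h5

/-- **`IndexPolyLaw` is false** (FACT A of the cell in the kernel: «index is not a polynomial resource»).  Against a would-be
exponent `c`, take the `DerivedPencilRolle` staircase with `L = 24c + 1` exponent classes and `n` even and large (`DPR.stub_arith
(2^c) (4c)`): a real symmetric pencil with `24c + 3` letters of size `m₀` and `n^L − 1` sign alternations, hence `≥ n^L − 1` distinct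
positive roots (IVT); its OneIndefinite lift is a pivot pencil of format `(m₀(24c+4), 48c+6)` with index witnessed `≤ m₀`, so
`IndexPolyLaw` would give `Z₊ ≤ ((m₀K+m₀)(2K+1))^c (m₀+1)^c ≤ K (2^c)^K (m₀+K)^{4c} < n^L − 1` — contradiction. [folklore] -/
theorem not_indexPolyLaw : ¬ IndexPolyLaw := by
  rintro ⟨c, hc⟩
  obtain ⟨n, hn, he, harith⟩ :=
    Summit.ValiantsHypothesis.ValiantsHypothesis.Theorems.SymmetroidDescartes.DPR.stub_arith (2 ^ c) (4 * c)
  have hL1 : 1 ≤ 6 * (4 * c) + 1 := by omega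
  have hnL : 1 ≤ n ^ (6 * (4 * c) + 1) := Nat.one_le_pow _ _ (by omega)
  obtain ⟨g, d, v₀, lam, wstar, cc, hlen, hlam, hcc, hgap, hsign⟩ :=
    Summit.ValiantsHypothesis.ValiantsHypothesis.Theorems.SymmetroidDescartes.DPR.stub_stair n (6 * (4 * c) + 1)
      (n ^ (6 * (4 * c) + 1) - 1) hn he hL1 (Nat.sub_add_cancel hnL)
  obtain ⟨S, ex, hS, τ, hτ, hpos, halt⟩ :=
    Summit.ValiantsHypothesis.ValiantsHypothesis.Theorems.SymmetroidDescartes.DPR.exists_symm_pencil_alternating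
      d g v₀ lam wstar cc hlam hcc hgap hsign
  have hroots :=
    Literature.LinearAlgebra.MatrixPolynomials.CameronPsarrakos2019.le_card_posRoots_of_alternating _ _ τ hτ hpos halt
  have hb := card_posRoots_le_of_pivotRootLawAt_lift (hc _ _ _) ex S hS
  have hchain := hroots.trans hb
  have hle := indexPolyLaw_budget_le c (6 * (4 * c) + 1 + 1 + 1)
    (4 * ((g.length + 1) * Fintype.card (Fin (2 ^ (6 * (4 * c) + 1) * n) × Bool)) ^ 3 + 7) (by omega) (by omega)
  have hchain' := hchain.trans hle
  rw [hlen, Fintype.card_prod, Fintype.card_fin, Fintype.card_bool] at hchain'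
  have hK : 6 * (4 * c) + 1 + 1 + 1 = 6 * (4 * c) + 3 := by ring
  rw [hK] at hchain'
  exact absurd (lt_of_le_of_lt hchain' harith) (lt_irrefl _)

end Summit.ValiantsHypothesis.ValiantsHypothesis.Theorems.LacunarySymmetroidMatrixDescartes.Pivot
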